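import Literature.RepresentationTheory.Semisimple.GradedOrbitReaching
import Literature.RepresentationTheory.Semisimple.GradedOrbitDegreewise
import HarnessLib

/-!
# Graded modules with a degree-one endomorphism, V: the conjugacy theorem

This file is part of a small self-contained series (`GradedOrbitStrings`, `GradedOrbitRetract`,
`GradedOrbitReaching`, `GradedOrbitDegreewise`, `GradedOrbitConj`) proving the following
**conjugacy theorem** (`exists_graded_linearEquiv_conj`): let `R` be a ring containing a field
`K`, `M = ⨁_{k<N} gr k` a graded `R`-module, finite-dimensional over `K` and semisimple over
`R`, and `t`, `t'` two `R`-endomorphisms of degree `+1` which are *generic* — no non-zero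
`R`-endomorphism of degree `-1` commutes with them; then `t' = g t g⁻¹` for a degree-preserving
`R`-automorphism `g`.  For `R = K` this is the uniqueness of the rigid (= open-orbit)
representation of the equioriented quiver of type `A` with a given dimension vector; in the
language of Zelevinsky (*Induced representations of reductive 𝔭-adic groups II*, Ann. ÉNS 13
(1980), §§4, 8) it says that the multisegment with pairwise *unlinked* segments on a given
support is unique.  With `R = ℂ[W_K]` acting through a twisted Weil-group action it yields
A'Campo–Hevesi–Thorne–Whitmore, arXiv:2607.11763, Prop. 6.0.5 (2) (generic monodromy
operators on a fixed Frobenius-semisimple Weil representation form one orbit under the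
centraliser), see `Literature/NumberTheory/GaloisRepresentations/GenericWeilDeligneOrbitProofs`.

The proof is elementary and module-theoretic (no algebraic geometry, no Gabriel / Krull–Schmidt):
a *string* is `Z = ⨁_{r ≤ n} tʳ e(S)` for a simple `S` and `e : S → gr p`; a string born in a
degree `p` below which `S` does not occur splits off `t`-stably and compatibly with the grading
(`exists_isCompl_stringSum`); genericity passes to such summands; in a generic module the string
born at the bottom of a maximal interval of degrees occupied by `S` reaches its top
(`exists_comp_pow_ne_zero_of_occupied`); split off such longest strings for `t` and `t'`, cancel
the simple summands degreewise, and induct on `dim_K M`.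

Conventions.  Everything is stated without auxiliary definitions: a grading is a family
`gr : ℕ → Submodule R M` (with `iSupIndep gr`, `⨆ gr = ⊤` and `gr k = ⊥` for `k ≥ N` where
needed); "`t` has degree `+1`" is `∀ k, ∀ x ∈ gr k, t x ∈ gr (k + 1)`; a *string sum* is any
linear map `Ψ : (Fin (n+1) → S) →ₗ[R] M` with `Ψ s = ∑ r, t ^ (a + r) (e (s r))` (hypothesis
`hΨ`), so that lemmas apply to `∑ r, (t ^ r ∘ₗ e) ∘ₗ LinearMap.proj r` by `simp`.

## This file

* `exists_graded_linearEquiv_conj_aux` — the induction carrier, for two graded modules `M`, `M'`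
  with isomorphic homogeneous components: choose a simple type `S` occurring in `M`, the bottom
  `p` of its lowest occupied interval of degrees and the top `q` of that interval; by part III
  there are strings of length `q - p + 1` from degree `p` for `t` in `M` and for `t'` in `M'`;
  split both off (part I), pass genericity and the grading to the complements (part II), cancel
  degreewise (part IV), apply the induction hypothesis to the complements and glue with the
  obvious isomorphism of the two strings;
* `exists_graded_linearEquiv_conj` — **the theorem** (`M' = M`).
-/

namespace Literature.RepresentationTheory.Semisimple

open Module

variable {R : Type*} [Ring R] {M : Type*} [AddCommGroup M] [Module R M]

section Main

variable (K : Type*) [Field K] [Algebra K R]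

/-- **Conjugacy of generic degree-one endomorphisms of graded semisimple modules** (induction
carrier; two graded modules with isomorphic homogeneous components).  Let `M = ⨁ gr k`,
`M' = ⨁ gr' k` be finite-dimensional graded semisimple `R`-modules with `gr k ≅ gr' k` for
all `k`, and `t`, `t'` degree `+1` endomorphisms which are *generic*: no non-zero degree `-1`
endomorphism commutes with them.  Then there is a graded `R`-isomorphism `g : M ≅ M'` with
`g t = t' g`.  (For the equioriented type-`A` quiver / graded `K[t]`-modules with semisimple
coefficients this is the statement that the rigid representation of given dimension vector
is unique, i.e. Zelevinsky's "the pairwise unlinked multisegment on a given support is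
unique"; proved here from scratch: split off a longest string at the bottom of an occupied
interval on both sides, cancel, and induct on the dimension.) [folklore] -/
theorem exists_graded_linearEquiv_conj_aux (n : ℕ) :
    ∀ {M : Type*} [AddCommGroup M] [Module K M] [Module R M] [IsScalarTower K R M]
      [FiniteDimensional K M] [IsSemisimpleModule R M]
      {M' : Type*} [AddCommGroup M'] [Module K M'] [Module R M'] [IsScalarTower K R M']
      [FiniteDimensional K M'] [IsSemisimpleModule R M']
      (gr : ℕ → Submodule R M) (_ : iSupIndep gr) (_ : ⨆ k, gr k = ⊤)
      (gr' : ℕ → Submodule R M') (_ : iSupIndep gr') (_ : ⨆ k, gr' k = ⊤)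
      (N : ℕ) (_ : ∀ k, N ≤ k → gr k = ⊥) (_ : ∀ k, N ≤ k → gr' k = ⊥)
      (_ : ∀ k, Nonempty (gr k ≃ₗ[R] gr' k))
      (t : M →ₗ[R] M) (_ : ∀ k, ∀ x ∈ gr k, t x ∈ gr (k + 1))
      (_ : ∀ f : M →ₗ[R] M, (∀ x ∈ gr 0, f x = 0) →
        (∀ k, ∀ x ∈ gr (k + 1), f x ∈ gr k) → f ∘ₗ t = t ∘ₗ f → f = 0)
      (t' : M' →ₗ[R] M') (_ : ∀ k, ∀ x ∈ gr' k, t' x ∈ gr' (k + 1))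
      (_ : ∀ f : M' →ₗ[R] M', (∀ x ∈ gr' 0, f x = 0) →
        (∀ k, ∀ x ∈ gr' (k + 1), f x ∈ gr' k) → f ∘ₗ t' = t' ∘ₗ f → f = 0),
      finrank K M ≤ n →
      ∃ g : M ≃ₗ[R] M', (∀ k, ∀ x ∈ gr k, g x ∈ gr' k) ∧ ∀ x, g (t x) = t' (g x) := by
  induction n with
  | zero =>
    intro M _ _ _ _ _ _ M' _ _ _ _ _ _ gr hind hsup gr' hind' hsup' N hN hN' hiso t ht hgen
      t' ht' hgen' hdim
    haveI : Subsingleton M := Module.finrank_zero_iff.mp (Nat.le_zero.mp hdim)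
    exact exists_linearEquiv_of_forall_eq_bot gr hsup gr' hsup' hiso
      (fun k => Subsingleton.elim _ _) t t'
  | succ n ih =>
    intro M _ _ _ _ _ _ M' _ _ _ _ _ _ gr hind hsup gr' hind' hsup' N hN hN' hiso t ht hgen
      t' ht' hgen' hdim
    classical
    by_cases hzero : ∀ k, gr k = ⊥
    · exact exists_linearEquiv_of_forall_eq_bot gr hsup gr' hsup' hiso hzero t t'
    push Not at hzero
    obtain ⟨k₁, hk₁⟩ := hzero
    -- a simple type `S` occurring in `M`
    obtain ⟨m, hm, hmS⟩ := (IsSemisimpleModule.eq_bot_or_exists_simple_le (gr k₁)).resolve_left hk₁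
    haveI := hmS
    -- occupancy of degrees by `S := m`, in `M` and in `M'`
    have hOcc_iff : ∀ j, (∃ u : m →ₗ[R] M, u ≠ 0 ∧ ∀ s, u s ∈ gr j) ↔
        (∃ u : m →ₗ[R] M', u ≠ 0 ∧ ∀ s, u s ∈ gr' j) := by
      intro j
      obtain ⟨e⟩ := hiso j
      constructor
      · rintro ⟨u, hu0, hu⟩
        refine ⟨(gr' j).subtype ∘ₗ e.toLinearMap ∘ₗ u.codRestrict (gr j) hu, ?_, fun s => by simp⟩
        intro h0; apply hu0; ext s
        have h1 : ((e (u.codRestrict (gr j) hu s) : gr' j) : M') = 0 := congr($h0 s)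
        have h2 : u.codRestrict (gr j) hu s = 0 := by
          apply e.injective; rw [map_zero]; exact Subtype.ext h1
        exact congrArg Subtype.val h2
      · rintro ⟨u, hu0, hu⟩
        refine ⟨(gr j).subtype ∘ₗ e.symm.toLinearMap ∘ₗ u.codRestrict (gr' j) hu, ?_,
          fun s => by simp⟩
        intro h0; apply hu0; ext s
        have h1 : ((e.symm (u.codRestrict (gr' j) hu s) : gr j) : M) = 0 := congr($h0 s)
        have h2 : u.codRestrict (gr' j) hu s = 0 := by
          apply e.symm.injective; rw [map_zero]; exact Subtype.ext h1
        exact congrArg Subtype.val h2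
    have hnocc_iff : ∀ j, (∀ u : m →ₗ[R] M, (∀ s, u s ∈ gr j) → u = 0) ↔
        ¬ ∃ u : m →ₗ[R] M, u ≠ 0 ∧ ∀ s, u s ∈ gr j := by
      intro j
      constructor
      · rintro h ⟨u, hu0, hu⟩; exact hu0 (h u hu)
      · intro h u hu; by_contra hne; exact h ⟨u, hne, hu⟩
    have hex_occ : ∃ j, ∃ u : m →ₗ[R] M, u ≠ 0 ∧ ∀ s, u s ∈ gr j := by
      refine ⟨k₁, m.subtype, ?_, fun s => hm s.2⟩
      intro h0
      haveI := IsSimpleModule.nontrivial R m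
      obtain ⟨s, hs⟩ := exists_ne (0 : m)
      exact hs (Subtype.ext (congr($h0 s)))
    set p := Nat.find hex_occ with hp
    have hp_occ : ∃ u : m →ₗ[R] M, u ≠ 0 ∧ ∀ s, u s ∈ gr p := Nat.find_spec hex_occ
    have hp_below : ∀ k, k + 1 = p → ∀ u : m →ₗ[R] M, (∀ s, u s ∈ gr k) → u = 0 := by
      intro k hk
      rw [hnocc_iff]
      exact Nat.find_min hex_occ (show k < p by omega)
    have hex_end : ∃ j, ¬ ∃ u : m →ₗ[R] M, u ≠ 0 ∧ ∀ s, u s ∈ gr (p + j + 1) := by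
      refine ⟨N, ?_⟩
      rintro ⟨u, hu0, hu⟩
      apply hu0; ext s
      have := hu s
      rw [hN (p + N + 1) (by omega), Submodule.mem_bot] at this
      rw [this, LinearMap.zero_apply]
    set j₀ := Nat.find hex_end with hj₀
    have hq_end : ¬ ∃ u : m →ₗ[R] M, u ≠ 0 ∧ ∀ s, u s ∈ gr (p + j₀ + 1) := Nat.find_spec hex_end
    have hocc : ∀ k, p ≤ k → k ≤ p + j₀ → ∃ u : m →ₗ[R] M, u ≠ 0 ∧ ∀ s, u s ∈ gr k := by
      intro k hk1 hk2
      rcases Nat.eq_or_lt_of_le hk1 with h | h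
      · rw [← h]; exact hp_occ
      · have := Nat.find_min hex_end (show k - p - 1 < j₀ by omega)
        rw [not_not, show p + (k - p - 1) + 1 = k by omega] at this
        exact this
    set q := p + j₀ with hq
    -- long strings on both sides
    obtain ⟨e, he, hec⟩ := exists_comp_pow_ne_zero_of_occupied (K := K) (finrank K M) gr hind
      hsup N hN t ht hgen p q (by omega) hp_below hocc le_rfl
    obtain ⟨e', he', hec'⟩ := exists_comp_pow_ne_zero_of_occupied (K := K) (finrank K M') gr'
      hind' hsup' N hN' t' ht' hgen' p q (by omega)
      (fun k hk u hu => by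
        have := hp_below k hk
        rw [hnocc_iff, hOcc_iff] at this
        by_contra hne
        exact this ⟨u, hne, hu⟩)
      (fun k hk1 hk2 => (hOcc_iff k).mp (hocc k hk1 hk2)) le_rfl
    set c := q - p with hc
    have hec1 : (t ^ (c + 1)) ∘ₗ e = 0 := by
      by_contra hne
      apply hq_end
      rw [show p + j₀ + 1 = q + 1 by omega]
      refine ⟨(t ^ (c + 1)) ∘ₗ e, hne, fun s => ?_⟩
      have := pow_apply_mem_gr gr t ht (he s) (c + 1)
      rwa [show p + (c + 1) = q + 1 by omega] at this
    have hec1' : (t' ^ (c + 1)) ∘ₗ e' = 0 := by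
      by_contra hne
      apply hq_end
      rw [hOcc_iff, show p + j₀ + 1 = q + 1 by omega]
      refine ⟨(t' ^ (c + 1)) ∘ₗ e', hne, fun s => ?_⟩
      have := pow_apply_mem_gr gr' t' ht' (he' s) (c + 1)
      rwa [show p + (c + 1) = q + 1 by omega] at this
    have hp_below' : ∀ k, k + 1 = p → ∀ u : m →ₗ[R] M', (∀ s, u s ∈ gr' k) → u = 0 := by
      intro k hk u hu
      have := hp_below k hk
      rw [hnocc_iff, hOcc_iff] at this
      by_contra hne
      exact this ⟨u, hne, hu⟩
    -- the string maps
    let Ψ : (Fin (c + 1) → m) →ₗ[R] M :=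
      ∑ r : Fin (c + 1), ((t ^ (r : ℕ)) ∘ₗ e) ∘ₗ LinearMap.proj r
    have hΨ : ∀ s, Ψ s = ∑ r : Fin (c + 1), (t ^ (r : ℕ)) (e (s r)) := by
      intro s; simp [Ψ, LinearMap.sum_apply]
    have hΨ0 : ∀ s, Ψ s = ∑ r : Fin (c + 1), (t ^ (0 + (r : ℕ))) (e (s r)) := by
      simpa using hΨ
    let Ψ' : (Fin (c + 1) → m) →ₗ[R] M' :=
      ∑ r : Fin (c + 1), ((t' ^ (r : ℕ)) ∘ₗ e') ∘ₗ LinearMap.proj r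
    have hΨ' : ∀ s, Ψ' s = ∑ r : Fin (c + 1), (t' ^ (r : ℕ)) (e' (s r)) := by
      intro s; simp [Ψ', LinearMap.sum_apply]
    have hΨ'0 : ∀ s, Ψ' s = ∑ r : Fin (c + 1), (t' ^ (0 + (r : ℕ))) (e' (s r)) := by
      simpa using hΨ'
    obtain ⟨hΨinj, C, hZC, hCt, hsplit⟩ :=
      exists_isCompl_stringSum gr hind hsup t ht e he hec hp_below Ψ hΨ
    obtain ⟨hΨ'inj, C', hZ'C', hC't', hsplit'⟩ :=
      exists_isCompl_stringSum gr' hind' hsup' t' ht' e' he' hec' hp_below' Ψ' hΨ'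
    set Z := LinearMap.range Ψ with hZdef
    set Z' := LinearMap.range Ψ' with hZ'def
    have hZt : ∀ x ∈ Z, t x ∈ Z := by
      rintro _ ⟨s, rfl⟩
      rw [apply_stringSum_eq_stringSum_shift t e 0 (by simpa using hec1) Ψ hΨ0 s]
      exact ⟨_, rfl⟩
    have hZ't : ∀ x ∈ Z', t' x ∈ Z' := by
      rintro _ ⟨s, rfl⟩
      rw [apply_stringSum_eq_stringSum_shift t' e' 0 (by simpa using hec1') Ψ' hΨ'0 s]
      exact ⟨_, rfl⟩
    have hdeg : ∀ k, ∀ x ∈ gr k, ∃ z ∈ Z, ∃ y ∈ C, y ∈ gr k ∧ x = z + y := by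
      intro k x hx
      obtain ⟨r, s₀, y, hyC, hyk, -, rfl⟩ := hsplit k x hx
      exact ⟨_, ⟨_, rfl⟩, y, hyC, hyk, rfl⟩
    have hdeg' : ∀ k, ∀ x ∈ gr' k, ∃ z ∈ Z', ∃ y ∈ C', y ∈ gr' k ∧ x = z + y := by
      intro k x hx
      obtain ⟨r, s₀, y, hyC, hyk, -, rfl⟩ := hsplit' k x hx
      exact ⟨_, ⟨_, rfl⟩, y, hyC, hyk, rfl⟩
    -- the complements as graded modules
    set grC : ℕ → Submodule R C := fun k => (gr k).comap C.subtype with hgrC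
    set grC' : ℕ → Submodule R C' := fun k => (gr' k).comap C'.subtype with hgrC'
    obtain ⟨hindC, hsupC⟩ := iSupIndep_comap_subtype_of_isCompl gr hind hsup Z C hZC hdeg
    obtain ⟨hindC', hsupC'⟩ := iSupIndep_comap_subtype_of_isCompl gr' hind' hsup' Z' C' hZ'C' hdeg'
    have hNC : ∀ k, N ≤ k → grC k = ⊥ := by
      intro k hk
      simp only [hgrC, hN k hk, Submodule.comap_bot, Submodule.ker_subtype]
    have hNC' : ∀ k, N ≤ k → grC' k = ⊥ := by
      intro k hk
      simp only [hgrC', hN' k hk, Submodule.comap_bot, Submodule.ker_subtype]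
    set tC : C →ₗ[R] C := t.restrict hCt with htC
    set tC' : C' →ₗ[R] C' := t'.restrict hC't' with htC'
    have htC1 : ∀ k, ∀ x ∈ grC k, tC x ∈ grC (k + 1) := fun k x hx => ht k x hx
    have htC1' : ∀ k, ∀ x ∈ grC' k, tC' x ∈ grC' (k + 1) := fun k x hx => ht' k x hx
    have hgenC : ∀ f : C →ₗ[R] C, (∀ x ∈ grC 0, f x = 0) →
        (∀ k, ∀ x ∈ grC (k + 1), f x ∈ grC k) → f ∘ₗ tC = tC ∘ₗ f → f = 0 :=
      forall_eq_zero_of_isCompl_restrict gr t hgen Z C hZC hZt hCt hdeg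
    have hgenC' : ∀ f : C' →ₗ[R] C', (∀ x ∈ grC' 0, f x = 0) →
        (∀ k, ∀ x ∈ grC' (k + 1), f x ∈ grC' k) → f ∘ₗ tC' = tC' ∘ₗ f → f = 0 :=
      forall_eq_zero_of_isCompl_restrict gr' t' hgen' Z' C' hZ'C' hZ't hC't' hdeg'
    haveI : FiniteDimensional K C := finite_of_submodule K C
    haveI : FiniteDimensional K C' := finite_of_submodule K C'
    have hdimC : finrank K C ≤ n := by
      have h1 := finrank_add_finrank_of_isCompl K hZC
      haveI := finite_of_submodule K Z
      haveI : Nontrivial Z := by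
        rw [Submodule.nontrivial_iff_ne_bot]
        intro hZ0
        apply hec
        have he0 : e = 0 := by
          ext s
          have hmem : Ψ (Pi.single 0 s) ∈ Z := ⟨_, rfl⟩
          rw [hZ0, Submodule.mem_bot, stringSum_single t e 0 Ψ hΨ0 0 s] at hmem
          simpa using hmem
        rw [he0, LinearMap.comp_zero]
      have h2 : 0 < finrank K Z := Module.finrank_pos
      omega
    have hΨdeg : ∀ (r : Fin (c + 1)) (s : m), Ψ (Pi.single r s) ∈ gr (p + r) := by
      intro r s
      rw [stringSum_single t e 0 Ψ hΨ0 r s]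
      simpa using pow_apply_mem_gr gr t ht (he s) r
    have hΨ'deg : ∀ (r : Fin (c + 1)) (s : m), Ψ' (Pi.single r s) ∈ gr' (p + r) := by
      intro r s
      rw [stringSum_single t' e' 0 Ψ' hΨ'0 r s]
      simpa using pow_apply_mem_gr gr' t' ht' (he' s) r
    have hisoC : ∀ k, Nonempty (grC k ≃ₗ[R] grC' k) := fun k =>
      nonempty_linearEquiv_comap_compl K gr gr' hiso Ψ Ψ' hΨinj hΨ'inj hΨdeg hΨ'deg C C'
        hZC.disjoint hZ'C'.disjoint hsplit hsplit' k
    obtain ⟨gC, hgC, hgCt⟩ := ih grC hindC hsupC grC' hindC' hsupC' N hNC hNC' hisoC tC htC1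
      hgenC tC' htC1' hgenC' hdimC
    -- assemble `g = gZ ⊕ gC`
    let θ := LinearEquiv.ofInjective Ψ hΨinj
    let θ' := LinearEquiv.ofInjective Ψ' hΨ'inj
    let gZ : Z ≃ₗ[R] Z' := θ.symm ≪≫ₗ θ'
    have hgZ : ∀ s, (gZ ⟨Ψ s, LinearMap.mem_range_self _ _⟩ : M') = Ψ' s := by
      intro s
      change ((θ' (θ.symm ⟨Ψ s, _⟩) : Z') : M') = Ψ' s
      have : θ.symm ⟨Ψ s, LinearMap.mem_range_self _ _⟩ = s := by
        apply hΨinj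
        exact LinearEquiv.ofInjective_symm_apply (f := Ψ) (h := hΨinj) _
      rw [this]
      rfl
    let g : M ≃ₗ[R] M' := (Submodule.prodEquivOfIsCompl Z C hZC).symm ≪≫ₗ (gZ.prodCongr gC) ≪≫ₗ
      Submodule.prodEquivOfIsCompl Z' C' hZ'C'
    have hgz : ∀ z : Z, g z = (gZ z : M') := by
      intro z
      change Submodule.prodEquivOfIsCompl Z' C' hZ'C'
        ((gZ.prodCongr gC) ((Submodule.prodEquivOfIsCompl Z C hZC).symm z)) = _
      rw [Submodule.prodEquivOfIsCompl_symm_apply_left, LinearEquiv.prodCongr_apply,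
        Submodule.coe_prodEquivOfIsCompl', map_zero, Submodule.coe_zero, add_zero]
    have hgy : ∀ y : C, g y = (gC y : M') := by
      intro y
      change Submodule.prodEquivOfIsCompl Z' C' hZ'C'
        ((gZ.prodCongr gC) ((Submodule.prodEquivOfIsCompl Z C hZC).symm y)) = _
      rw [Submodule.prodEquivOfIsCompl_symm_apply_right, LinearEquiv.prodCongr_apply,
        Submodule.coe_prodEquivOfIsCompl', map_zero, Submodule.coe_zero, zero_add]
    have hgΨ : ∀ s, g (Ψ s) = Ψ' s := fun s => by
      rw [show Ψ s = ((⟨Ψ s, LinearMap.mem_range_self _ _⟩ : Z) : M) from rfl, hgz, hgZ]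
    refine ⟨g, ?_, ?_⟩
    · intro k x hx
      obtain ⟨r, s₀, y, hyC, hyk, hs₀, rfl⟩ := hsplit k x hx
      rw [map_add, hgΨ, hgy ⟨y, hyC⟩]
      refine add_mem ?_ (hgC k ⟨y, hyC⟩ hyk)
      by_cases h0 : s₀ = 0
      · rw [h0, Pi.single_zero, map_zero]; exact zero_mem _
      · rw [← hs₀ h0]; exact hΨ'deg r s₀
    · intro x
      obtain ⟨z, ⟨s, rfl⟩, y, hy, rfl⟩ := Submodule.mem_sup.mp
        ((hZC.sup_eq_top.symm ▸ Submodule.mem_top : x ∈ Z ⊔ C))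
      rw [map_add, map_add, map_add]
      have e1 : t (Ψ s) = Ψ (Fin.cons 0 (Fin.init s)) :=
        apply_stringSum_eq_stringSum_shift t e 0 (by simpa using hec1) Ψ hΨ0 s
      have e1' : t' (Ψ' s) = Ψ' (Fin.cons 0 (Fin.init s)) :=
        apply_stringSum_eq_stringSum_shift t' e' 0 (by simpa using hec1') Ψ' hΨ'0 s
      rw [e1, hgΨ, hgΨ, map_add, e1']
      have e2 : t y = ((tC ⟨y, hy⟩ : C) : M) := rfl
      rw [e2, hgy, show g y = (gC ⟨y, hy⟩ : M') from hgy ⟨y, hy⟩, hgCt]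
      rfl

/-- **Conjugacy of generic degree-one endomorphisms of a graded semisimple module.**  Let
`M = ⨁_{k < N} gr k` be a finite-dimensional graded semisimple `R`-module (`R` an algebra over
the coefficient field `K`) and `t`, `t'` two degree `+1` endomorphisms, both *generic*: the
only degree `-1` endomorphism commuting with `t` (resp. `t'`) is `0`.  Then `t' = g t g⁻¹` for
a degree-preserving `R`-automorphism `g` of `M`.  (Equivalently: for the equioriented quiver of
type `A` with coefficients in semisimple `R`-modules, two rigid representations with the same
dimension data are isomorphic — the uniqueness of the pairwise-unlinked Zelevinsky multisegment
on a given support.) [folklore] -/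
theorem exists_graded_linearEquiv_conj {M : Type*} [AddCommGroup M] [Module K M] [Module R M]
    [IsScalarTower K R M] [FiniteDimensional K M] [IsSemisimpleModule R M]
    (gr : ℕ → Submodule R M) (hind : iSupIndep gr) (hsup : ⨆ k, gr k = ⊤)
    (N : ℕ) (hN : ∀ k, N ≤ k → gr k = ⊥)
    (t t' : M →ₗ[R] M) (ht : ∀ k, ∀ x ∈ gr k, t x ∈ gr (k + 1))
    (ht' : ∀ k, ∀ x ∈ gr k, t' x ∈ gr (k + 1))
    (hgen : ∀ f : M →ₗ[R] M, (∀ x ∈ gr 0, f x = 0) →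
      (∀ k, ∀ x ∈ gr (k + 1), f x ∈ gr k) → f ∘ₗ t = t ∘ₗ f → f = 0)
    (hgen' : ∀ f : M →ₗ[R] M, (∀ x ∈ gr 0, f x = 0) →
      (∀ k, ∀ x ∈ gr (k + 1), f x ∈ gr k) → f ∘ₗ t' = t' ∘ₗ f → f = 0) :
    ∃ g : M ≃ₗ[R] M, (∀ k, ∀ x ∈ gr k, g x ∈ gr k) ∧ ∀ x, g (t x) = t' (g x) :=
  exists_graded_linearEquiv_conj_aux K (finrank K M) gr hind hsup gr hind hsup N hN hN
    (fun _ => ⟨LinearEquiv.refl R _⟩) t ht hgen t' ht' hgen' le_rfl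

end Main

end Literature.RepresentationTheory.Semisimple
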